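import Mathlib
import HarnessLib
import Summits.ValiantsHypothesis.ValiantsHypothesis.Theorems.MonotoneRestorationOrbitRestorationQPSmlFlattening

/-!
# The flattening bound for AFFINE column-set-multilinear `ΣΠΣ` expressions (constants allowed)
(crux `OrbitRestorationQP`, stmt-ValiantsHypothesis-18293 — lane SML of stub A_∞ `stub_sigmaPiSigmaValue`, extension to
depth-three circuits WITH CONSTANTS)

`…SmlFlattening.lean` (F5b of the landed set-multilinear stratum) treats `f = Σ_{t<s} Π_b L_{t,b}` with column-LINEAR forms
`L_{t,b} = Σ_a α_{t,b,a} x_{(a,b)}`.  A genuine column-set-multilinear `ΣΠΣ` CIRCUIT has AFFINE gates: its product gates compute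
`Π_b A_{t,b}` with `A_{t,b} = β_{t,b} + Σ_a α_{t,b,a} x_{(a,b)}`, and the polynomial is then no longer homogeneous.  This file
shows that the flattening bound survives constants VERBATIM: a constant dies under `∂_{(a,b₀)}`, so

* `pderiv_affineForm`, `pderiv_C_mul_prod_affineForms`, `pderivFold_prod_affineForms` — the iterated derivative of
  `C c · Π_{b∈U} A_{t,b}` along a row tuple `ρ` and a column tuple `κ` is zero unless `κ` is injective with values in `U`, and
  then equals `C (c · Π_i α_{t,κ i,ρ i}) · Π_{b ∈ U ∖ im κ} A_{t,b}` (same formula as in the linear case);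
* `derivs_rename_fst_mem_span_affine` — **AFFINE FLATTENING BOUND**: if `f = Σ_{t<s} Π_b A_{t,b}` is COLUMN-SYMMETRIC, then
  for every `ρ : Fin j → Fin n` (`j ≤ n`) the iterated partial `∂_{ρ(0)} ⋯ ∂_{ρ(j-1)}` of `p = rename Prod.fst f` lies in the
  span of the AT MOST `s` polynomials `rename fst (Π_{b ≥ j} A_{t,b})`, `t < s` (column symmetry moves every injective column
  tuple to the first `j` columns, `SmlFlattening.rename_fst_pderivFold_of_colSymm`).

Consequence (next file of the lane): every HOMOGENEOUS COMPONENT of `p` has `j`-th flattening rank `≤ s`, hence narrow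
power-sum support when `s < C(n-j, j)` (`SmlLowRankNarrow.narrow_of_derivs_in_small_span`).  Honest label: helper lemmas for a
stratum of the off-path sub-rung A_∞; nothing here closes a stub; VP ≠ VNP untouched. [folklore]
-/

set_option linter.dupNamespace false

namespace Summit.ValiantsHypothesis.ValiantsHypothesis.Theorems.SmlAffineFlattening

open MvPolynomial SmlDeltaCalculus SmlChainRule SmlFlattening

/-! ### Derivatives of products of column-affine forms -/

/-- `∂_{(a,b₀)}` of an AFFINE form supported in column `b`: the constant dies. [folklore] -/
theorem pderiv_affineForm {n : ℕ} (γ : ℂ) (β : Fin n → ℂ) (b b₀ a : Fin n) :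
    pderiv (a, b₀) (C γ + ∑ a' : Fin n, C (β a') * X (a', b) : MvPolynomial (Fin n × Fin n) ℂ) =
      if b = b₀ then C (β a) else 0 := by
  rw [map_add, pderiv_C, zero_add, pderiv_linearForm]

/-- One derivative `∂_{(a,b₀)}` of `C c · Π_{b∈U} A_{t,b}` (affine column forms): it extracts the coefficient of `x_{(a,b₀)}`
and removes the factor of column `b₀` (or kills everything if `b₀ ∉ U`). [folklore] -/
theorem pderiv_C_mul_prod_affineForms {n : ℕ} (β : Fin n → ℂ) (α : Fin n → Fin n → ℂ) (U : Finset (Fin n)) (c : ℂ)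
    (a b₀ : Fin n) :
    pderiv (a, b₀) (C c * ∏ b ∈ U, (C (β b) + ∑ a' : Fin n, C (α b a') * X (a', b)) : MvPolynomial (Fin n × Fin n) ℂ) =
      if b₀ ∈ U then C (c * α b₀ a) * ∏ b ∈ U.erase b₀, (C (β b) + ∑ a' : Fin n, C (α b a') * X (a', b)) else 0 := by
  rw [pderiv_C_mul]
  by_cases hb : b₀ ∈ U
  · rw [if_pos hb, ← Finset.mul_prod_erase U _ hb, pderiv_mul, pderiv_affineForm, if_pos rfl,
      pderiv_prod_eq_zero _ _ _ (fun b hb' => by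
        rw [pderiv_affineForm, if_neg (Finset.ne_of_mem_erase hb')]), mul_zero, add_zero, ← mul_assoc, ← map_mul]
  · rw [if_neg hb, pderiv_prod_eq_zero _ _ _ (fun b hb' => by
      rw [pderiv_affineForm, if_neg]
      rintro rfl
      exact hb hb'), mul_zero]

/-- **Iterated derivative of a product of column-affine forms** along row tuple `ρ` and column tuple `κ`: zero unless `κ` is
injective with values in `U`, and then the product of the extracted coefficients times the product over the remaining columns —
the same formula as for column-linear forms (`SmlFlattening.pderivFold_prod_linearForms`). [folklore] -/
theorem pderivFold_prod_affineForms {n : ℕ} (β : Fin n → ℂ) (α : Fin n → Fin n → ℂ) :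
    ∀ (j : ℕ) (ρ κ : Fin j → Fin n) (U : Finset (Fin n)) (c : ℂ),
      List.foldl (fun (q : MvPolynomial (Fin n × Fin n) ℂ) i => pderiv (ρ i, κ i) q)
        (C c * ∏ b ∈ U, (C (β b) + ∑ a' : Fin n, C (α b a') * X (a', b))) (List.finRange j) =
      if Function.Injective κ ∧ ∀ i, κ i ∈ U then
        C (c * ∏ i, α (κ i) (ρ i)) * ∏ b ∈ U \ Finset.univ.image κ, (C (β b) + ∑ a' : Fin n, C (α b a') * X (a', b))
      else 0 := by
  intro j
  induction j with
  | zero =>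
    intro ρ κ U c
    rw [if_pos ⟨fun i => Fin.elim0 i, fun i => Fin.elim0 i⟩]
    simp
  | succ j ih =>
    intro ρ κ U c
    rw [List.finRange_succ, List.foldl_cons, List.foldl_map, pderiv_C_mul_prod_affineForms]
    by_cases h0 : κ 0 ∈ U
    · rw [if_pos h0]
      rw [show (List.foldl (fun (q : MvPolynomial (Fin n × Fin n) ℂ) i => pderiv (ρ i.succ, κ i.succ) q)
          (C (c * α (κ 0) (ρ 0)) * ∏ b ∈ U.erase (κ 0), (C (β b) + ∑ a' : Fin n, C (α b a') * X (a', b)))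
          (List.finRange j)) =
          List.foldl (fun (q : MvPolynomial (Fin n × Fin n) ℂ) i =>
            pderiv ((fun i => ρ i.succ) i, (fun i => κ i.succ) i) q)
          (C (c * α (κ 0) (ρ 0)) * ∏ b ∈ U.erase (κ 0), (C (β b) + ∑ a' : Fin n, C (α b a') * X (a', b)))
          (List.finRange j)
          from rfl, ih]
      -- compare the two conditions and the two right-hand sides
      have hcond : (Function.Injective (fun i : Fin j => κ i.succ) ∧ ∀ i : Fin j, κ i.succ ∈ U.erase (κ 0)) ↔
          (Function.Injective κ ∧ ∀ i, κ i ∈ U) := by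
        constructor
        · rintro ⟨hinj, hmem⟩
          refine ⟨?_, fun i => Fin.cases h0 (fun i => Finset.mem_of_mem_erase (hmem i)) i⟩
          have hκ : κ = Fin.cons (κ 0) (fun i => κ i.succ) := by
            funext i; refine Fin.cases ?_ (fun i => ?_) i <;> simp
          rw [hκ]
          refine Fin.cons_injective_of_injective ?_ hinj
          rintro ⟨i, hi⟩
          exact Finset.ne_of_mem_erase (hmem i) hi
        · rintro ⟨hinj, hmem⟩
          refine ⟨hinj.comp (Fin.succ_injective j), fun i => ?_⟩
          exact Finset.mem_erase.2 ⟨fun h => Fin.succ_ne_zero i (hinj h), hmem i.succ⟩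
      by_cases hc : Function.Injective κ ∧ ∀ i, κ i ∈ U
      · rw [if_pos (hcond.2 hc), if_pos hc, Fin.prod_univ_succ, ← mul_assoc]
        congr 2
        ext b
        simp only [Finset.mem_sdiff, Finset.mem_erase, Finset.mem_image, Finset.mem_univ, true_and, not_exists]
        constructor
        · rintro ⟨⟨hne, hbU⟩, hno⟩
          exact ⟨hbU, fun i => Fin.cases (Ne.symm hne) (fun i => hno i) i⟩
        · rintro ⟨hbU, hno⟩
          exact ⟨⟨fun h => hno 0 h.symm, hbU⟩, fun i => hno i.succ⟩
      · rw [if_neg (fun h => hc (hcond.1 h)), if_neg hc]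
    · rw [if_neg h0, pderivFoldList_zero, if_neg]
      rintro ⟨_, hmem⟩
      exact h0 (hmem 0)

/-! ### The affine flattening bound -/

/-- **Affine flattening bound.**  For a column-symmetric AFFINE column-set-multilinear `ΣΠΣ` expression
`f = Σ_{t<s} Π_b (β_{t,b} + Σ_a α_{t,b,a} x_{(a,b)})` and `j ≤ n`, every `j`-th order iterated partial derivative of
`p = rename fst f` lies in the span of the `≤ s` polynomials `rename fst (Π_{b ∉ {0,…,j-1}} A_{t,b})`. [folklore] -/
theorem derivs_rename_fst_mem_span_affine {n s j : ℕ} (hjn : j ≤ n) (β : Fin s → Fin n → ℂ) (α : Fin s → Fin n → Fin n → ℂ)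
    (hcol : ∀ τ : Equiv.Perm (Fin n), rename (fun v : Fin n × Fin n => (v.1, τ v.2))
      (∑ t : Fin s, ∏ b : Fin n, (C (β t b) + ∑ a : Fin n, C (α t b a) * X (a, b)) : MvPolynomial (Fin n × Fin n) ℂ) =
      ∑ t : Fin s, ∏ b : Fin n, (C (β t b) + ∑ a : Fin n, C (α t b a) * X (a, b)))
    (ρ : Fin j → Fin n) :
    List.foldl (fun (q : MvPolynomial (Fin n) ℂ) i => pderiv (ρ i) q)
        (rename (Prod.fst : Fin n × Fin n → Fin n)
          (∑ t : Fin s, ∏ b : Fin n, (C (β t b) + ∑ a : Fin n, C (α t b a) * X (a, b)))) (List.finRange j) ∈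
      Submodule.span ℂ ((Finset.univ.image fun t : Fin s => rename (Prod.fst : Fin n × Fin n → Fin n)
        (∏ b ∈ Finset.univ \ Finset.univ.image (fun i : Fin j => (⟨(i : ℕ), by omega⟩ : Fin n)),
          (C (β t b) + ∑ a : Fin n, C (α t b a) * X (a, b))) : Finset (MvPolynomial (Fin n) ℂ)) :
            Set (MvPolynomial (Fin n) ℂ)) := by
  classical
  -- the canonical injective column tuple
  have hκ₀ : Function.Injective (fun i : Fin j => (⟨(i : ℕ), by omega⟩ : Fin n)) := by
    intro i i' h; simp only [Fin.mk.injEq] at h; exact Fin.ext h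
  rw [pderivFold_rename_fst]
  refine Submodule.sum_mem _ fun κ _ => ?_
  by_cases hκ : Function.Injective κ
  · -- move `κ` to the canonical tuple by column symmetry, then compute explicitly
    rw [rename_fst_pderivFold_of_colSymm _ hcol ρ _ κ hκ₀ hκ, pderivFoldList_sum, map_sum]
    refine Submodule.sum_mem _ fun t _ => ?_
    have h := pderivFold_prod_affineForms (β t) (α t) j ρ (fun i : Fin j => (⟨(i : ℕ), by omega⟩ : Fin n)) Finset.univ 1
    rw [map_one, one_mul] at h
    rw [h, if_pos ⟨hκ₀, fun i => Finset.mem_univ _⟩, map_mul, rename_C, one_mul]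
    refine Submodule.smul_mem _ _ ?_ |> fun hm => by rw [← smul_eq_C_mul]; exact hm
    exact Submodule.subset_span (Finset.mem_coe.2 (Finset.mem_image_of_mem _ (Finset.mem_univ t)))
  · -- non-injective column tuples give zero
    rw [pderivFoldList_sum, map_sum]
    refine Submodule.sum_mem _ fun t _ => ?_
    have h := pderivFold_prod_affineForms (β t) (α t) j ρ κ Finset.univ 1
    rw [map_one, one_mul] at h
    rw [h, if_neg (fun h' => hκ h'.1), map_zero]
    exact Submodule.zero_mem _

end Summit.ValiantsHypothesis.ValiantsHypothesis.Theorems.SmlAffineFlattening
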